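import Summits.ResolutionOfSingularities.ResolutionOfSingularities.Theorems.FrobeniusLadderFRationalModificationFrobeniusSandwich
import Mathlib.Algebra.CharP.Algebra
import HarnessLib

/-!
# A rung-2 local domain radicial over an F-rational subring is rung-3
(crux `FrobeniusLadder.FRationalModification`, stmt-ResolutionOfSingularities-15316 — the "bottom"
half of idea card `artin-schreier-mirror-wild-core-collapse`'s lever `WildCoreCollapse`, the converse
companion of `FrobeniusSandwich.rungThree_of_frobeniusSandwich`; asked for by crux-triage r1-2 as the
support `rungThree_of_radicialOverFRational`)

The crux asks to pass from rung 2 (locally integral, Cohen–Macaulay, parameter ideals FROBENIUS closed)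
to rung 3 (domain, parameter ideals TIGHTLY closed, i.e. F-rational) by a proper birational
modification. `FrobeniusSandwich` (tree, p142808) proved that rung 3 is free for a rung-2 ring lying
UNDER an F-rational Frobenius sandwich (`R ⊆ S`, `S^q ⊆ R`, `S` F-rational). This file proves the
mirror statement for a rung-2 ring lying OVER an F-rational ring: let `A ⊆ R` be local rings with
`A → R` injective and `R^q ⊆ A` for some `q = p^e` (so `Spec R → Spec A` is a finite universal
homeomorphism — `R` is *radicial* over `A`), `A` F-rational (every ideal generated by a system of
parameters tightly closed; e.g. `A` regular, `RegularStalksClimb`), and `R` a domain all of whose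
parameter ideals are Frobenius closed (the Frobenius half of the route's rung-2 clause). Then every
parameter ideal of `R` satisfies the route's rung-3 clause (`rungThree_of_radicialOverFRational`), i.e.
`R` is F-rational (`isFRational_of_radicialOverFRational`).

Proof (six lines on paper, crux-triage r1-2). Fix a system of parameters `s` of `R` and choose
`tᵢ ∈ A` with `tᵢ = sᵢ^q`. (1) `t` is a system of parameters of `A`: `dim A = dim R` (integral
extension), the `tᵢ` are non-units, and for `a ∈ 𝔪_A` some power `a^N` lies in `(s)R`, so — raising
to the `q`-th power, which turns the `R`-coefficients into elements of `A` — `a^(Nq) ∈ (t)A`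
(`mem_span_of_map_eq_pow`, injectivity of `A → R`). (2) If `c ≠ 0` and `c·y^Q ∈ (s)^[Q]` in `R` for
all `Q`, then with `z := y^q ∈ A`, `c' := c^q ∈ A` the same twist gives `c'·z^Q ∈ (t)^[Q]` in `A` for
all `Q ≥ q`, so `z ∈ (t)^* = (t)` by F-rationality of `A`; mapping back, `y^q ∈ (s)^[q]` in `R`, and
Frobenius closedness of `(s)` gives `y ∈ (s)`. No flatness, no Cohen–Macaulayness and no test elements
are used. Together with `FrobeniusSandwich` this makes rung 3 automatic on the whole radicial sandwich
class around F-rational (e.g. regular) schemes: a disprover of the crux must look elsewhere, and an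
F-rationalification engine may stop as soon as a model is radicial over or under an F-rational one.

## References

* M. Hochster, C. Huneke, *F-regularity, test elements, and smooth base change*, Trans. AMS 346 (1994),
  §4 (F-rational rings). [HochsterHuneke1994]
* R. Fedder, K.-i. Watanabe, *A characterization of F-regularity in terms of F-purity*, MSRI Publ. 15
  (1989), Def. 1.10, Remark 1.9. [FedderWatanabe1989]
* J. Kenkel, K. Maddox, T. Polstra, A. Simpson, *F-nilpotent rings and permanence properties*,
  arXiv:1912.01150, Thm. 4.5 (F-nilpotence persists along purely inseparable faithfully flat local
  maps; with "F-rational = CM + F-injective + F-nilpotent" this is the statement in print nearest to the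
  present one) — the proof here is elementary and assumes neither flatness nor Cohen–Macaulayness.
-/

-- single-problem summit: the doubled namespace component `ResolutionOfSingularities` is forced
set_option linter.dupNamespace false

noncomputable section

open IsLocalRing Literature.RingTheory.TightClosure

namespace Summit.ResolutionOfSingularities.ResolutionOfSingularities.Theorems.FRationalModification.RadicialOverFRational

open FrobeniusSandwich

/-- **One Frobenius twist pulls a membership down a radicial extension.** Let `A → R` be injective
with `R^(p^e) ⊆ A` (`R` of characteristic `p`), `u : Fin d → R`, and `w : Fin d → A` with
`wᵢ = uᵢ^(p^e)` in `R`. If `x ∈ (u)R` and `x' ∈ A` maps to `x^(p^e)`, then `x' ∈ (w)A`: write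
`x = Σ rᵢ uᵢ`, raise to the `p^e`-th power (additive in characteristic `p`) and note `rᵢ^(p^e) ∈ A`.
[folklore] -/
theorem mem_span_of_map_eq_pow (p : ℕ) [Fact p.Prime] {A R : Type*} [CommRing A] [CommRing R]
    [Algebra A R] [CharP R p] (hinj : Function.Injective (algebraMap A R)) (e : ℕ)
    (hrad : ∀ r : R, r ^ p ^ e ∈ (algebraMap A R).range)
    {d : ℕ} {u : Fin d → R} {w : Fin d → A} (hw : ∀ i, algebraMap A R (w i) = u i ^ p ^ e)
    {x : R} (hx : x ∈ Ideal.span (Set.range u)) {x' : A}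
    (hx' : algebraMap A R x' = x ^ p ^ e) :
    x' ∈ Ideal.span (Set.range w) := by
  obtain ⟨r, hr⟩ := Ideal.mem_span_range_iff_exists_fun.mp hx
  choose b hb using fun i => RingHom.mem_range.mp (hrad (r i))
  have hxq : x' = ∑ i, b i * w i := by
    apply hinj
    rw [hx', ← hr, sum_pow_char_pow p e, map_sum]
    refine Finset.sum_congr rfl fun i _ => ?_
    rw [map_mul, hb, hw, mul_pow]
  rw [hxq]
  exact Ideal.sum_mem _ fun i _ => Ideal.mul_mem_left _ _ (Ideal.subset_span ⟨i, rfl⟩)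

/-- **A system of parameters of `R` twists to one of `A`.** With `A → R` injective local rings,
`R^(p^e) ⊆ A`, `dim A = d`, `s : Fin d → R` with `rad (s) = 𝔪_R` and `tᵢ ∈ A` mapping to `sᵢ^(p^e)`:
`rad (t) = 𝔪_A`, i.e. `t` is a system of parameters of `A` (the `tᵢ` are non-units; for `a ∈ 𝔪_A`,
`a^N ∈ (s)R` for some `N`, hence `a^(N·p^e) ∈ (t)A` by `mem_span_of_map_eq_pow`). [folklore] -/
theorem isSystemOfParameters_twist (p : ℕ) [Fact p.Prime] {A R : Type*} [CommRing A] [CommRing R]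
    [IsLocalRing A] [IsLocalRing R] [Algebra A R] [CharP R p]
    (hinj : Function.Injective (algebraMap A R)) (e : ℕ)
    (hrad : ∀ r : R, r ^ p ^ e ∈ (algebraMap A R).range)
    {d : ℕ} (hdA : ringKrullDim A = d) {s : Fin d → R}
    (hs : (Ideal.span (Set.range s)).radical.IsMaximal) {t : Fin d → A}
    (ht : ∀ i, algebraMap A R (t i) = s i ^ p ^ e) :
    IsSystemOfParameters t := by
  have hp : p.Prime := Fact.out
  haveI : IsLocalHom (algebraMap A R) := isLocalHom_of_sandwich hp e hrad
  have hsR : (Ideal.span (Set.range s)).radical = maximalIdeal R := eq_maximalIdeal hs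
  refine ⟨hdA, ?_⟩
  -- `(t) ⊆ 𝔪_A`: `tᵢ ↦ sᵢ^q ∈ 𝔪_R`, and `A → R` reflects units
  have htle : Ideal.span (Set.range t) ≤ maximalIdeal A := by
    refine Ideal.span_le.mpr ?_
    rintro _ ⟨i, rfl⟩
    have hsi : s i ∈ maximalIdeal R :=
      hsR ▸ Ideal.le_radical (Ideal.subset_span ⟨i, rfl⟩)
    have hsiq : s i ^ p ^ e ∈ maximalIdeal R :=
      Ideal.pow_mem_of_mem _ hsi _ (pow_pos hp.pos e)
    refine (mem_maximalIdeal _).mpr fun hu => ?_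
    exact (mem_maximalIdeal _).mp hsiq (ht i ▸ hu.map (algebraMap A R))
  refine le_antisymm ((maximalIdeal.isMaximal A).isPrime.radical_le_iff.mpr htle) ?_
  -- `𝔪_A ⊆ rad (t)`: for `a ∈ 𝔪_A`, `a ↦ 𝔪_R = rad (s)`, so `(a)^N ∈ (s)R`, twist once
  intro a ha
  have haR : algebraMap A R a ∈ (Ideal.span (Set.range s)).radical :=
    hsR ▸ map_nonunit (algebraMap A R) a ha
  obtain ⟨N, hN⟩ := haR
  refine ⟨N * p ^ e, ?_⟩
  refine mem_span_of_map_eq_pow p hinj e hrad ht hN ?_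
  rw [map_pow, pow_mul]

/-- **A rung-2 local domain radicial over an F-rational local ring is rung-3.** Let `A → R` be an
injective homomorphism of local rings with `R^(p^e) ⊆ A` (`R` radicial over `A`: `Spec R → Spec A` is
a finite universal homeomorphism), `A` of characteristic `p` and F-rational (every ideal generated by a
system of parameters tightly closed — e.g. `A` regular), and `R` a domain every ideal of which
generated by a system of parameters is Frobenius closed (the Frobenius half of the route's rung-2
clause). Then every ideal of `R` generated by a system of parameters `s` satisfies the route's rung-3
clause: `c ≠ 0` and `c·y^(p^e') ∈ (s)^[p^e']` for all `e'` force `y ∈ (s)`. Proof: choose `tᵢ ∈ A`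
over `sᵢ^q`, a system of parameters of `A` (`isSystemOfParameters_twist`, `dim A = dim R`); with
`z ∈ A` over `y^q` and `c' ∈ A` over `c^q`, one Frobenius twist of the equations at exponent
`q·Q` gives `c'·z^Q ∈ (t)^[Q]` in `A` for all `Q ≥ q`, so `z ∈ (t)^* = (t)A`; mapping to `R`,
`y^q ∈ (s)^[q]`, and Frobenius closedness of `(s)` gives `y ∈ (s)`.
[cite: HochsterHuneke1994, §4 (Def. (4.1) of F-rational); FedderWatanabe1989, Remark 1.9] -/
theorem rungThree_of_radicialOverFRational (p : ℕ) [Fact p.Prime] {A R : Type*} [CommRing A]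
    [CommRing R] [IsLocalRing A] [IsLocalRing R] [IsDomain R] [CharP A p] [Algebra A R]
    (hinj : Function.Injective (algebraMap A R)) (e : ℕ)
    (hrad : ∀ r : R, r ^ p ^ e ∈ (algebraMap A R).range)
    (hA : IsFRational A p)
    (hR : ∀ d : ℕ, ringKrullDim R = d → ∀ s : Fin d → R,
      (Ideal.span (Set.range s)).radical.IsMaximal → ∀ y : R,
        (∃ e' : ℕ, y ^ p ^ e' ∈
          Ideal.span ((fun z : R => z ^ p ^ e') '' (Ideal.span (Set.range s) : Set R))) →
        y ∈ Ideal.span (Set.range s)) :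
    ∀ d : ℕ, ringKrullDim R = d → ∀ s : Fin d → R,
      (Ideal.span (Set.range s)).radical.IsMaximal → ∀ y c : R, c ≠ 0 →
        (∀ e' : ℕ, c * y ^ p ^ e' ∈
          Ideal.span ((fun z : R => z ^ p ^ e') '' (Ideal.span (Set.range s) : Set R))) →
        y ∈ Ideal.span (Set.range s) := by
  have hp : p.Prime := Fact.out
  haveI : CharP R p := charP_of_injective_algebraMap hinj p
  haveI : Algebra.IsIntegral A R := isIntegral_of_sandwich hp e hrad
  haveI : IsDomain A := Function.Injective.isDomain (algebraMap A R) hinj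
  have hdim : ringKrullDim A = ringKrullDim R :=
    Literature.RingTheory.KrullDimension.ringKrullDim_eq_of_isIntegral hinj
  intro d hd s hs y c hc hmem
  -- twist the data into `A`
  choose t ht using fun i => RingHom.mem_range.mp (hrad (s i))
  obtain ⟨z, hz⟩ := RingHom.mem_range.mp (hrad y)
  obtain ⟨c', hc'⟩ := RingHom.mem_range.mp (hrad c)
  have htsop : IsSystemOfParameters t :=
    isSystemOfParameters_twist p hinj e hrad (hdim.trans hd) hs ht
  -- `z ∈ (t)^*` in `A`, witnessed by `c'` at all exponents `≥ e`
  have hc'0 : c' ≠ 0 := by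
    intro h0
    apply pow_ne_zero (p ^ e) hc
    rw [← hc', h0, map_zero]
  have hzt : z ∈ tightClosure p (Ideal.span (Set.range t)) := by
    refine ⟨c', (mem_minimalPrimesCompl_iff_ne_zero).mpr hc'0, e, fun e' he' => ?_⟩
    obtain ⟨b, rfl⟩ := Nat.exists_eq_add_of_le he'
    -- at exponent `p^(e+b) = p^b · p^e`: `c · y^(p^(e+b)) ∈ (sᵢ^(p^(e+b)))`, twist once
    have hmem' : c * y ^ p ^ (e + b) ∈
        Ideal.span (Set.range fun i => s i ^ p ^ (e + b)) := by
      have h := hmem (e + b)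
      rw [← frobeniusPower_def, frobeniusPower_span, ← Set.range_comp] at h
      exact h
    rw [frobeniusPower_span, ← Set.range_comp]
    refine mem_span_of_map_eq_pow p hinj e hrad (u := fun i => s i ^ p ^ (e + b))
      (w := fun i => t i ^ p ^ (e + b)) (fun i => ?_) hmem' ?_
    · rw [map_pow, ht, ← pow_mul, ← pow_mul, mul_comm]
    · rw [map_mul, map_pow, hc', hz, mul_pow, ← pow_mul, ← pow_mul, mul_comm (p ^ e) (p ^ (e + b))]
  -- F-rationality of `A`: `z ∈ (t)A`
  have hzmem : z ∈ Ideal.span (Set.range t) := (isTightlyClosed_iff_le p).mp (hA t htsop) hzt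
  -- map back to `R`: `y^q ∈ (s)^[q]`
  refine hR d hd s hs y ⟨e, ?_⟩
  rw [← frobeniusPower_def, frobeniusPower_span, ← Set.range_comp]
  rw [← hz]
  have hcomp : (⇑(algebraMap A R) ∘ t) = ((fun x : R => x ^ p ^ e) ∘ s) := funext fun i => ht i
  have hmap : (Ideal.span (Set.range t)).map (algebraMap A R) =
      Ideal.span (Set.range ((fun x : R => x ^ p ^ e) ∘ s)) := by
    rw [Ideal.map_span, ← Set.range_comp, hcomp]
  exact hmap ▸ Ideal.mem_map_of_mem (algebraMap A R) hzmem

/-- **F-rationality ascends radicial extensions onto rung-2 domains** (the same statement in the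
tree's tight-closure vocabulary): under the hypotheses of `rungThree_of_radicialOverFRational`, `R` is
F-rational. [cite: HochsterHuneke1994, §4; FedderWatanabe1989, Def. 1.10] -/
theorem isFRational_of_radicialOverFRational (p : ℕ) [Fact p.Prime] {A R : Type*} [CommRing A]
    [CommRing R] [IsLocalRing A] [IsLocalRing R] [IsDomain R] [CharP A p] [CharP R p] [Algebra A R]
    (hinj : Function.Injective (algebraMap A R)) (e : ℕ)
    (hrad : ∀ r : R, r ^ p ^ e ∈ (algebraMap A R).range)
    (hA : IsFRational A p)
    (hR : ∀ d : ℕ, ringKrullDim R = d → ∀ s : Fin d → R,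
      (Ideal.span (Set.range s)).radical.IsMaximal → ∀ y : R,
        (∃ e' : ℕ, y ^ p ^ e' ∈
          Ideal.span ((fun z : R => z ^ p ^ e') '' (Ideal.span (Set.range s) : Set R))) →
        y ∈ Ideal.span (Set.range s)) :
    IsFRational R p :=
  (isFRational_iff_of_isDomain p).mpr (rungThree_of_radicialOverFRational p hinj e hrad hA hR)

end Summit.ResolutionOfSingularities.ResolutionOfSingularities.Theorems.FRationalModification.RadicialOverFRational

end
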